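import Mathlib
import HarnessLib
import Summits.ResolutionOfSingularities.ResolutionOfSingularities.Theorems.WildQuotientsWildQuotientResolutionS1aKillCharts
import Summits.ResolutionOfSingularities.ResolutionOfSingularities.Theorems.WildQuotientsWildQuotientResolutionS1aReachAux

/-!
# S1a — THE VALUATIVE REES FILTRATION OF A VALUATION CENTRED AT A POINT, and `KillValReach p ⇒ KillTouchReachAux p`

[OURS · L1 W4.5c · lead-1 g9, SUCCESSOR-BRIEF-v1 §4 item 1 (plan-1 g12, 10:56:19Z (4) "D-VAL") in its cheapest form] — NOT statements of the
manuscript; counted 0; AI-level work, weaker than expert review. Crux stmt-ResolutionOfSingularities-17941 (`WildQuotients.CyclicQuotientFourfolds`),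
line `s1a-logminvertex` v10, registered research stub `stub_killTouchReachAux`. Route-independent.

A **valuation centred at a point `ξ`** of a scheme `X` (`CentredVal X ξ`): an additive valuation `v` on the local ring `𝒪_{X,ξ}` with values in
`ℕ∞` (so `v ≥ 0` on `𝒪_{X,ξ}` — the centre condition) which vanishes only on units (`v f = 0 → IsUnit f`, i.e. `𝔪_ξ = {v > 0}`). Its
**valuative Rees filtration** `c.rees : ReesFiltration X` has pieces `𝒥ₙ(U) = {f ∈ Γ(U) : ξ ∈ U → v(f_ξ) ≥ n}` (`= ⊤` on the affine opens missing
`ξ`); the ideal-sheaf axiom `𝒥ₙ(D(g)) = 𝒥ₙ(U)·Γ(D(g))` is the computation "`v(g_ξ) = 0` if `ξ ∈ D(g)`, and `gⁿ ∈ 𝒥ₙ(U)` is a unit on `D(g)`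
otherwise" (`map_valIdeal_basicOpen`); `supp 𝒥ₙ = closure {ξ}` for `n ≥ 1` (`support_rees_ideal_eq`). No `G`-invariance of `v` is needed below.

**`KillValReach p`** (OURS CANDIDATE research statement, asserted nowhere — the K side as ONE CENTRED VALUATION): at every non-terminal model
AUX-reachable from the initial model of a crux datum with every bad point killable, there are a BAD point `ξ`, a valuation centred at `ξ`, a degree
`d > 0` and finitely many `G`-stable affine charts covering `closure {ξ}` on each of which the valuative Rees filtration is a PRINCIPAL-CENTRE CHART.
★★ `killTouchReachAux_of_killValReach`: it implies the registered `KillTouchReachAux p` — all charts carry THE SAME filtration, so the agreement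
clause (K1) of `KillCharts.exists_isPrincipalCentre_of_charts` is `rfl` and (K3) is `supp = closure {ξ} ⊆ ⋃ Oᵢ`; the glued principal centre contains
the bad point `ξ` in its support (G1). This is where census certificates (monomial valuations in adapted coordinates at a node chart) plug in.
-/

set_option linter.dupNamespace false

noncomputable section

universe u

open CategoryTheory Limits AlgebraicGeometry TopologicalSpace Topology Opposite
open Literature.AlgebraicGeometry.Resolution Literature.AlgebraicGeometry.RelativeSpec
open Summit.ResolutionOfSingularities.ResolutionOfSingularities.Theorems.WildQuotientResolution.S1
open Summit.ResolutionOfSingularities.ResolutionOfSingularities.Theorems.WildQuotientResolution.S1.NodeAtlas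
open Summit.ResolutionOfSingularities.ResolutionOfSingularities.Theorems.WildQuotientResolution.S1.KillGlue
open Summit.ResolutionOfSingularities.ResolutionOfSingularities.Theorems.WildQuotientResolution.S1.KillCharts

namespace Summit.ResolutionOfSingularities.ResolutionOfSingularities.Theorems.WildQuotientResolution.S1

namespace Valuative

variable {X : Scheme.{u}} {ξ : X}

/-- **A valuation centred at the point `ξ` of `X`**: an additive valuation on the local ring `𝒪_{X,ξ}` with values in `ℕ∞` (hence non-negative
on `𝒪_{X,ξ}`), vanishing only on units (`𝔪_ξ = {v > 0}`). [OURS · L1 W4.5c] -/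
structure CentredVal (X : Scheme.{u}) (ξ : X) where
  /-- the valuation on the local ring at `ξ` -/
  v : AddValuation (X.presheaf.stalk ξ) ℕ∞
  /-- the centre condition: `v f = 0` only for units -/
  isUnit_of_map_eq_zero : ∀ f : X.presheaf.stalk ξ, v f = 0 → IsUnit f

namespace CentredVal

variable (c : CentredVal X ξ)

/-- A valuation with values in `ℕ∞` vanishes on units. -/
theorem map_eq_zero_of_isUnit {f : X.presheaf.stalk ξ} (hf : IsUnit f) : c.v f = 0 := by
  obtain ⟨w, hw⟩ := hf.exists_right_inv
  have h : c.v f + c.v w = 0 := by rw [← AddValuation.map_mul, hw, AddValuation.map_one]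
  exact nonpos_iff_eq_zero.1 (le_of_le_of_eq le_self_add h)

/-- `v f = 0 ↔ f` is a unit. -/
theorem map_eq_zero_iff (f : X.presheaf.stalk ξ) : c.v f = 0 ↔ IsUnit f :=
  ⟨c.isUnit_of_map_eq_zero f, c.map_eq_zero_of_isUnit⟩

/-- `1 ≤ v f ↔ f` is not a unit. -/
theorem one_le_map_iff (f : X.presheaf.stalk ξ) : 1 ≤ c.v f ↔ ¬ IsUnit f := by
  rw [Order.one_le_iff_pos, pos_iff_ne_zero, Ne, c.map_eq_zero_iff]

/-- Germs along a smaller open (`hom` form of `germ_res`). -/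
theorem germ_res_hom {U V : X.Opens} (h : U ≤ V) (hξ : ξ ∈ U) (f : Γ(X, V)) :
    (X.presheaf.germ U ξ hξ).hom ((X.presheaf.map (homOfLE h).op).hom f) = (X.presheaf.germ V ξ (h hξ)).hom f := by
  rw [← RingHom.comp_apply, ← CommRingCat.hom_comp, TopCat.Presheaf.germ_res]

/-- **The `n`-th valuation ideal on an affine open `U`**: `{f : ξ ∈ U → v(f_ξ) ≥ n}` (so `⊤` if `ξ ∉ U`). [OURS · L1 W4.5c] -/
def valIdeal (n : ℕ) (U : X.affineOpens) : Ideal Γ(X, U) where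
  carrier := {f | ∀ hξ : ξ ∈ U.1, (n : ℕ∞) ≤ c.v ((X.presheaf.germ U.1 ξ hξ).hom f)}
  zero_mem' := fun hξ => by simp
  add_mem' := fun {a b} ha hb hξ => by
    rw [Set.mem_setOf_eq] at ha hb
    rw [map_add]
    exact (le_min (ha hξ) (hb hξ)).trans (c.v.map_add _ _)
  smul_mem' := fun a {f} hf hξ => by
    rw [Set.mem_setOf_eq] at hf
    rw [smul_eq_mul, map_mul, AddValuation.map_mul]
    exact le_add_left (hf hξ)

/-- Membership in the valuation ideal. -/
theorem mem_valIdeal_iff {n : ℕ} {U : X.affineOpens} (f : Γ(X, U)) :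
    f ∈ c.valIdeal n U ↔ ∀ hξ : ξ ∈ U.1, (n : ℕ∞) ≤ c.v ((X.presheaf.germ U.1 ξ hξ).hom f) := Iff.rfl

/-- Off `ξ` the valuation ideals are everything. -/
theorem valIdeal_eq_top_of_not_mem {n : ℕ} {U : X.affineOpens} (hξ : ξ ∉ U.1) : c.valIdeal n U = ⊤ :=
  eq_top_iff.2 fun _ _ h => absurd h hξ

/-- The zeroth valuation ideal is everything. -/
theorem valIdeal_zero (U : X.affineOpens) : c.valIdeal 0 U = ⊤ :=
  eq_top_iff.2 fun _ _ _ => by simp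

/-- The valuation ideals decrease. -/
theorem valIdeal_antitone (U : X.affineOpens) : Antitone fun n => c.valIdeal n U :=
  fun _ _ h _ hf hξ => (Nat.cast_le.2 h).trans (hf hξ)

/-- The valuation ideals are multiplicative: `𝒥ₘ 𝒥ₙ ⊆ 𝒥ₘ₊ₙ`. -/
theorem valIdeal_mul_le (m n : ℕ) (U : X.affineOpens) : c.valIdeal m U * c.valIdeal n U ≤ c.valIdeal (m + n) U :=
  Ideal.mul_le.2 fun r hr s hs hξ => by
    rw [map_mul, AddValuation.map_mul, Nat.cast_add]
    exact add_le_add (hr hξ) (hs hξ)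

/-- ★ **The ideal-sheaf axiom** `𝒥ₙ(U)·Γ(D(g)) = 𝒥ₙ(D(g))`: if `ξ ∈ D(g)` a section `f/gᵏ` of `𝒥ₙ(D(g))` has `v(f_ξ) = v((f/gᵏ)_ξ) + k·v(g_ξ) ≥ n`;
if `ξ ∈ U ∖ D(g)` then `v(g_ξ) ≥ 1`, so `gⁿ ∈ 𝒥ₙ(U)` becomes a unit; if `ξ ∉ U` both sides are `⊤`. [OURS · L1 W4.5c] -/
theorem map_valIdeal_basicOpen (n : ℕ) (U : X.affineOpens) (g : Γ(X, U)) :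
    (c.valIdeal n U).map (X.presheaf.map (homOfLE <| X.basicOpen_le g).op).hom = c.valIdeal n (X.affineBasicOpen g) := by
  set r := (X.presheaf.map (homOfLE <| X.basicOpen_le g).op).hom with hr
  apply le_antisymm
  · refine Ideal.map_le_iff_le_comap.2 fun f hf hξ' => ?_
    change (n : ℕ∞) ≤ c.v ((X.presheaf.germ (X.basicOpen g) ξ hξ').hom (r f))
    rw [hr, germ_res_hom (X.basicOpen_le g) hξ' f]
    exact hf (X.basicOpen_le g hξ')
  · intro s hs
    by_cases hξD : ξ ∈ X.basicOpen g
    · letI := U.2.isLocalization_basicOpen g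
      obtain ⟨⟨f, ⟨_, k, rfl⟩⟩, hfs⟩ := IsLocalization.surj (Submonoid.powers g) s
      have hu : IsUnit (algebraMap Γ(X, U) Γ(X, X.basicOpen g) (g ^ k)) :=
        IsLocalization.map_units (M := Submonoid.powers g) Γ(X, X.basicOpen g) ⟨g ^ k, k, rfl⟩
      change s * r (g ^ k) = r f at hfs
      change IsUnit (r (g ^ k)) at hu
      have hf : f ∈ c.valIdeal n U := by
        intro hξ
        have e : (X.presheaf.germ U.1 ξ hξ).hom f = (X.presheaf.germ (X.basicOpen g) ξ hξD).hom s *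
            (X.presheaf.germ (X.basicOpen g) ξ hξD).hom (r (g ^ k)) := by
          rw [← map_mul, hfs, hr, germ_res_hom (X.basicOpen_le g) hξD f]
        rw [e, AddValuation.map_mul]
        exact le_add_right (hs hξD)
      have e' : s = r f * ↑hu.unit⁻¹ := by rw [← hfs, mul_assoc, IsUnit.mul_val_inv, mul_one]
      rw [e']
      exact Ideal.mul_mem_right _ _ (Ideal.mem_map_of_mem r hf)
    · have hgn : g ^ n ∈ c.valIdeal n U := by
        intro hξ
        rw [map_pow, AddValuation.map_pow]
        have h1 : (1 : ℕ∞) ≤ c.v ((X.presheaf.germ U.1 ξ hξ).hom g) := by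
          rw [one_le_map_iff, ← Scheme.mem_basicOpen]
          exact hξD
        calc (n : ℕ∞) = n • (1 : ℕ∞) := by simp
          _ ≤ n • c.v ((X.presheaf.germ U.1 ξ hξ).hom g) := nsmul_le_nsmul_right h1 n
      have hu : IsUnit (r (g ^ n)) := by
        letI := U.2.isLocalization_basicOpen g
        exact IsLocalization.map_units (M := Submonoid.powers g) Γ(X, X.basicOpen g) ⟨g ^ n, n, rfl⟩
      rw [Ideal.eq_top_of_isUnit_mem _ (Ideal.mem_map_of_mem r hgn) hu]
      exact Submodule.mem_top

/-- **The `n`-th valuation ideal sheaf.** [OURS · L1 W4.5c] -/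
def valIdealSheaf (n : ℕ) : X.IdealSheafData where
  ideal := c.valIdeal n
  map_ideal_basicOpen := c.map_valIdeal_basicOpen n

/-- Unfolding. -/
@[simp] theorem valIdealSheaf_ideal (n : ℕ) (U : X.affineOpens) : (c.valIdealSheaf n).ideal U = c.valIdeal n U := rfl

/-- ★ **The valuative Rees filtration** `(𝒥ₙ)ₙ` of a centred valuation. [OURS · L1 W4.5c] -/
def rees : ReesFiltration X where
  ideal := c.valIdealSheaf
  ideal_zero := Scheme.IdealSheafData.ext (funext fun U => c.valIdeal_zero U)
  antitone _ _ h := Scheme.IdealSheafData.le_def.2 fun U => c.valIdeal_antitone U h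
  mul_le m n := Scheme.IdealSheafData.le_def.2 fun U => by
    rw [Scheme.IdealSheafData.ideal_mul, Pi.mul_apply]
    exact c.valIdeal_mul_le m n U

/-- Unfolding the pieces of the valuative Rees filtration on an affine open. -/
@[simp] theorem rees_filtration_ideal (U : X.affineOpens) (n : ℕ) : (c.rees.filtration U).ideal n = c.valIdeal n U := rfl

/-- Unfolding the ideal sheaves of the valuative Rees filtration. -/
@[simp] theorem rees_ideal_ideal (n : ℕ) (U : X.affineOpens) : (c.rees.ideal n).ideal U = c.valIdeal n U := rfl

/-- The support of every piece lies in `closure {ξ}` (off `closure {ξ}` a point has an affine neighbourhood missing `ξ`, where the piece is `⊤`). -/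
theorem support_rees_ideal_subset (n : ℕ) : ((c.rees.ideal n).support : Set X) ⊆ closure {ξ} := by
  intro x hx
  by_contra hxc
  obtain ⟨_, ⟨W, hW, rfl⟩, hxW, hWsub⟩ := X.isBasis_affineOpens.exists_subset_of_mem_open (Set.mem_compl hxc) isClosed_closure.isOpen_compl
  have hξW : ξ ∉ W := fun h => hWsub h (subset_closure rfl)
  have h := (Scheme.IdealSheafData.mem_support_iff_of_mem (I := c.rees.ideal n) (U := ⟨W, hW⟩) hxW).1 hx
  rw [rees_ideal_ideal, c.valIdeal_eq_top_of_not_mem (U := ⟨W, hW⟩) hξW, Scheme.mem_zeroLocus_iff] at h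
  exact h 1 Submodule.mem_top ((Scheme.mem_basicOpen X (1 : Γ(X, W)) x hxW).2 (by rw [map_one]; exact isUnit_one))

/-- The centre `ξ` lies in the support of every positive piece (`v(f_ξ) ≥ 1` forces `f(ξ) = 0`). -/
theorem mem_support_rees_ideal {n : ℕ} (hn : 0 < n) : ξ ∈ ((c.rees.ideal n).support : Set X) := by
  obtain ⟨_, ⟨W, hW, rfl⟩, hξW, -⟩ := X.isBasis_affineOpens.exists_subset_of_mem_open (Set.mem_univ ξ) isOpen_univ
  refine (Scheme.IdealSheafData.mem_support_iff_of_mem (I := c.rees.ideal n) (U := ⟨W, hW⟩) hξW).2 ?_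
  rw [rees_ideal_ideal, Scheme.mem_zeroLocus_iff]
  intro f hf hξf
  have h1 : (1 : ℕ∞) ≤ c.v ((X.presheaf.germ W ξ hξW).hom f) := (Nat.one_le_cast.2 hn).trans (hf hξW)
  rw [one_le_map_iff] at h1
  exact h1 ((Scheme.mem_basicOpen X f ξ hξW).1 hξf)

/-- ★ **The support of every positive piece of the valuative Rees filtration is `closure {ξ}`.** [OURS · L1 W4.5c] -/
theorem support_rees_ideal_eq {n : ℕ} (hn : 0 < n) : ((c.rees.ideal n).support : Set X) = closure {ξ} :=
  (c.support_rees_ideal_subset n).antisymm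
    (closure_minimal (Set.singleton_subset_iff.2 (c.mem_support_rees_ideal hn)) (c.rees.ideal n).support.isClosed)

end CentredVal

end Valuative

open Valuative

/-- **`KillValReach p`** (OURS CANDIDATE research statement, asserted nowhere; the K side as ONE CENTRED VALUATION — SUCCESSOR-BRIEF-v1 §4 item 1
in its cheapest typed form): at every non-terminal model AUX-reachable from the initial model of a crux datum with every bad point killable
(`jInf = ⊥`), there are a BAD point `ξ`, a valuation `v` centred at `ξ` (on `𝒪_{V,ξ}`, values in `ℕ∞`), a degree `d > 0` and finitely many `G`-stable
affine charts `Oᵢ` covering `closure {ξ}` on each of which the valuative Rees filtration of `v` is a PRINCIPAL-CENTRE CHART of degree `d`. Implies the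
registered `KillTouchReachAux p` (`killTouchReachAux_of_killValReach`). [OURS · L1 W4.5c] -/
def KillValReach (p : ℕ) : Prop :=
  ∀ (k : Type) [Field k] [CharP k p] [PerfectField k] (X' X₁ : Scheme.{0})
    (f : X₁ ⟶ Spec (.of k)) (q : X' ⟶ X₁) (G : Type) [Group G] [Finite G]
    (ρ : G →* Aut X'), Nat.card G = p → IsSeparated f → LocallyOfFiniteType f → QuasiCompact f →
    IsIntegral X₁ → ∀ [IsIntegral X'], Scheme.IsRegular X' → IsFinite q → Function.Surjective q.base →
    (∃ U : X₁.Opens, Dense (U : Set X₁) ∧ Etale (q ∣_ U)) →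
    ∀ (hq : ∀ g : G, (ρ g).hom ≫ q = q),
    (∀ x y : X', q.base x = q.base y → ∃ g : G, (ρ g).hom.base x = y) →
    topologicalKrullDim X₁ ≤ 4 → Function.Injective ρ →
    ∀ (g₀ : G), (∀ g : G, g ∈ Subgroup.zpowers g₀) → ∀ [IsLocallyNoetherian X']
      (h₀ : NodeAtlas p (⟨ρ, hq⟩ : ActionOver q G) g₀),
      ∀ M : GameFrame.GModel p q G ρ g₀, (GameFrame.GModel.initial hq h₀).ReachableAux M → ¬ M.Terminal → M.jInf = ⊥ →
        ∃ (ξ : M.V) (c : CentredVal M.V ξ) (n : ℕ) (O : Fin n → M.act.StableAffineOpens) (d : ℕ), 0 < d ∧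
          ξ ∈ M.badLocus ∧ closure {ξ} ⊆ ⋃ i, ((O i).1 : Set M.V) ∧
          ∀ i, IsPrincipalCentreChart p M.act g₀ c.rees d (O i)

/-- ★★ **ONE CENTRED VALUATION WITH PRINCIPAL KILL CHARTS KILLS A BAD POINT**: `KillValReach p ⇒ KillTouchReachAux p`. All charts carry the same
filtration, so (K1) agreement is `rfl`; (K3) is `supp = closure {ξ} ⊆ ⋃ Oᵢ`; glue by `KillCharts.exists_isPrincipalCentre_of_charts`; the bad
centre `ξ` lies in a chart, hence in the support of the glued principal centre (G1). [OURS · L1 W4.5c] -/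
theorem killTouchReachAux_of_killValReach {p : ℕ} (hp : p.Prime) (h : KillValReach p) : KillTouchReachAux p := by
  intro k _ _ _ X' X₁ f q G _ _ ρ hG hfs hfft hfqc hX₁ _ hreg hqfin hqs hqet hq horb hdim hinj g₀ hg₀ _ h₀ M hR hT hj
  haveI := hfs
  haveI := hfft
  haveI := hqfin
  haveI : M.V.IsSeparated := isSeparated_of_datum f M
  obtain ⟨ξ, c, n, O, d, hd, hξ, hcov, hprin⟩ :=
    h k X' X₁ f q G ρ hG hfs hfft hfqc hX₁ hreg hqfin hqs hqet hq horb hdim hinj g₀ hg₀ h₀ M hR hT hj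
  have hcl : ∀ i : Fin n, closure (((c.rees.ideal d).support : Set M.V) ∩ (O i).1) ⊆ ⋃ k, ((O k).1 : Set M.V) := fun i =>
    (closure_mono Set.inter_subset_left).trans
      (((c.rees.ideal d).support.isClosed.closure_eq.le.trans (c.support_rees_ideal_subset d)).trans hcov)
  obtain ⟨J, hJ, -, -, hbad⟩ := exists_isPrincipalCentre_of_charts hp hg₀ M (GameFrame.GModel.hasNoetherianBase_of_datum f M) O
    (fun _ => c.rees) hd hprin (fun _ _ _ _ _ _ => rfl) hcl
  obtain ⟨i, hξi⟩ := Set.mem_iUnion.mp (hcov (subset_closure rfl))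
  exact ⟨J, d, hJ, ξ, hξ, hbad i ξ hξi hξ⟩

/-- **`KillValMeetReach p`** (OURS CANDIDATE research statement, asserted nowhere; WEAKER than `KillValReach p`): as `KillValReach p`, except that
the centre `closure {ξ}` of the valuation need only MEET the bad locus instead of having a bad generic point — kill centres may leave `Z(M)`
(e.g. a kill surface through a bad curve, cf. `KillChartsReach`). Still implies the registered `KillTouchReachAux p`
(`killTouchReachAux_of_killValMeetReach`). [OURS · L1 W4.5c] -/
def KillValMeetReach (p : ℕ) : Prop :=
  ∀ (k : Type) [Field k] [CharP k p] [PerfectField k] (X' X₁ : Scheme.{0})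
    (f : X₁ ⟶ Spec (.of k)) (q : X' ⟶ X₁) (G : Type) [Group G] [Finite G]
    (ρ : G →* Aut X'), Nat.card G = p → IsSeparated f → LocallyOfFiniteType f → QuasiCompact f →
    IsIntegral X₁ → ∀ [IsIntegral X'], Scheme.IsRegular X' → IsFinite q → Function.Surjective q.base →
    (∃ U : X₁.Opens, Dense (U : Set X₁) ∧ Etale (q ∣_ U)) →
    ∀ (hq : ∀ g : G, (ρ g).hom ≫ q = q),
    (∀ x y : X', q.base x = q.base y → ∃ g : G, (ρ g).hom.base x = y) →
    topologicalKrullDim X₁ ≤ 4 → Function.Injective ρ →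
    ∀ (g₀ : G), (∀ g : G, g ∈ Subgroup.zpowers g₀) → ∀ [IsLocallyNoetherian X']
      (h₀ : NodeAtlas p (⟨ρ, hq⟩ : ActionOver q G) g₀),
      ∀ M : GameFrame.GModel p q G ρ g₀, (GameFrame.GModel.initial hq h₀).ReachableAux M → ¬ M.Terminal → M.jInf = ⊥ →
        ∃ (ξ : M.V) (c : CentredVal M.V ξ) (n : ℕ) (O : Fin n → M.act.StableAffineOpens) (d : ℕ), 0 < d ∧
          (M.badLocus ∩ closure {ξ}).Nonempty ∧ closure {ξ} ⊆ ⋃ i, ((O i).1 : Set M.V) ∧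
          ∀ i, IsPrincipalCentreChart p M.act g₀ c.rees d (O i)

/-- `KillValReach p ⇒ KillValMeetReach p` (a bad centre meets the bad locus). [OURS · L1 W4.5c] -/
theorem killValMeetReach_of_killValReach {p : ℕ} (h : KillValReach p) : KillValMeetReach p := by
  intro k _ _ _ X' X₁ f q G _ _ ρ hG hfs hfft hfqc hX₁ _ hreg hqfin hqs hqet hq horb hdim hinj g₀ hg₀ _ h₀ M hR hT hj
  obtain ⟨ξ, c, n, O, d, hd, hξ, hcov, hprin⟩ :=
    h k X' X₁ f q G ρ hG hfs hfft hfqc hX₁ hreg hqfin hqs hqet hq horb hdim hinj g₀ hg₀ h₀ M hR hT hj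
  exact ⟨ξ, c, n, O, d, hd, ⟨ξ, hξ, subset_closure rfl⟩, hcov, hprin⟩

/-- ★★ `KillValMeetReach p ⇒ KillTouchReachAux p`: glue the charts of the one valuative filtration (agreement `rfl`, supports in `closure {ξ}`);
a bad point of `closure {ξ}` lies in a chart, hence in the support of the glued principal centre (G1). [OURS · L1 W4.5c] -/
theorem killTouchReachAux_of_killValMeetReach {p : ℕ} (hp : p.Prime) (h : KillValMeetReach p) : KillTouchReachAux p := by
  intro k _ _ _ X' X₁ f q G _ _ ρ hG hfs hfft hfqc hX₁ _ hreg hqfin hqs hqet hq horb hdim hinj g₀ hg₀ _ h₀ M hR hT hj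
  haveI := hfs
  haveI := hfft
  haveI := hqfin
  haveI : M.V.IsSeparated := isSeparated_of_datum f M
  obtain ⟨ξ, c, n, O, d, hd, ⟨z, hz, hzξ⟩, hcov, hprin⟩ :=
    h k X' X₁ f q G ρ hG hfs hfft hfqc hX₁ hreg hqfin hqs hqet hq horb hdim hinj g₀ hg₀ h₀ M hR hT hj
  have hcl : ∀ i : Fin n, closure (((c.rees.ideal d).support : Set M.V) ∩ (O i).1) ⊆ ⋃ k, ((O k).1 : Set M.V) := fun i =>
    (closure_mono Set.inter_subset_left).trans
      (((c.rees.ideal d).support.isClosed.closure_eq.le.trans (c.support_rees_ideal_subset d)).trans hcov)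
  obtain ⟨J, hJ, -, -, hbad⟩ := exists_isPrincipalCentre_of_charts hp hg₀ M (GameFrame.GModel.hasNoetherianBase_of_datum f M) O
    (fun _ => c.rees) hd hprin (fun _ _ _ _ _ _ => rfl) hcl
  obtain ⟨i, hzi⟩ := Set.mem_iUnion.mp (hcov hzξ)
  exact ⟨J, d, hJ, z, hz, hbad i z hzi hz⟩

end Summit.ResolutionOfSingularities.ResolutionOfSingularities.Theorems.WildQuotientResolution.S1

end
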